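import Literature.AlgebraicGeometry.Resolution.DefectlessResidueCharZero
import Literature.AlgebraicGeometry.Resolution.DefectTowers
import Literature.AlgebraicGeometry.Resolution.DefectlessComposite
import Literature.AlgebraicGeometry.Resolution.ValuationConjugation
import Mathlib.GroupTheory.FiniteAbelian.Duality
import Mathlib.RingTheory.RootsOfUnity.AlgebraicallyClosed
import Mathlib.FieldTheory.Fixed
import Mathlib.FieldTheory.Normal.Closure
import Mathlib.FieldTheory.Galois.Basic
import HarnessLib

/-!
# Henselian fields of residue characteristic `0` are defectless (Ostrowski's lemma with `p = 1`) — discharge of `Kuhlmann2010DefectlessOfResidueCharZero`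

Topic: `Literature/AlgebraicGeometry/Resolution` (valued function fields). D-0014 keeps
`Literature/` sorry-free by stating cited results as named facts `def X : Prop`; this file
PROVES the named fact `Kuhlmann2010DefectlessOfResidueCharZero` (`HenselizedFunctionFields.lean`)
= F.-V. Kuhlmann, *Elimination of ramification I: The generalized stability theorem*, Trans. AMS
362 (2010) 5697–5727 = arXiv:1003.5678, **Cor. 2.12** (p. 7 of the arXiv text):

> Assume that `(L|K,v)` is a finite extension and the extension of `v` from `K` to `L` is unique.
> Then the Lemma of Ostrowski says that `[L:K] = (vL:vK)·[Lv:Kv]·p^ν` with `ν ≥ 0` (9) where `p`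
> is the characteristic exponent of `Kv`, that is, `p = char Kv` if this is positive, and `p = 1`
> otherwise (cf. [En], [R]). … Note that `(L|K,v)` is always defectless if `char Kv = 0`.
> Therefore, **Corollary 2.12.** Every valued field `(K,v)` with `char Kv = 0` is a defectless
> field.

(§1, p. 3: "Every valued field of residue characteristic `0` is defectless; this is a consequence
of the 'Lemma of Ostrowski'".) The reduction of Cor. 2.12 to the henselian case — extend `v` to
`K̃`, pass to the henselization `K^h`, which is henselian, immediate over `K`, and defectless iff
`K` is (Thm. 2.14) — is PROVED in `DefectlessResidueCharZero.lean`
(`Kuhlmann2010DefectlessOfResidueCharZero.of_ostrowski`, from the full Lemma of Ostrowski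
`Kuhlmann2010OstrowskiLemma`). What this file supplies is **Ostrowski's lemma in residue
characteristic `0`** (`p = 1`: a henselian field of residue characteristic `0` is a defectless
field, `isDefectlessField_of_isHenselianField_of_charZero`), by the classical ramification theory
of a finite Galois extension `M|K` whose valuation ring `O_M` is the only one over `O_M ∩ K`
(Zariski–Samuel, *Commutative Algebra* II, Ch. VI §12: Thm. 24 "`G_V` is a `π`-group … In
particular, `G_V = (1)` if `Δ` has characteristic zero", Thm. 25 and its Corollary "The product
`efg` divides the degree `n = [K* : K]`, and `n/efg` is a power of `π`"), run at the level of
finite Galois theory: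

1. `valuation_algEquiv_apply` — every `σ ∈ G = Aut(M|K)` stabilises `O_M`, hence PRESERVES the
   valuation (`σ` has finite order, and `x ∈ O_M ↔ σ x ∈ O_M` makes `v` and `v ∘ σ`
   order-equivalent: `|x| < |σx|` would give `|x| < |σx| < ⋯ < |σⁿx| = |x|`).
2. `residueGaloisHom` — the action `σ ↦ σ̄` of `G` on the residue field `κ(O_M)` by automorphisms
   over `κ(O_M ∩ K)`; its kernel `I` is the inertia group, and
   `[G : I] ≤ #Aut(κ(O_M)|κ(O_M ∩ K)) ≤ [κ(O_M) : κ(O_M ∩ K)] = f`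
   (`card_quotient_ker_residueGaloisHom_le`, Dedekind–Artin: Mathlib's `AlgEquiv.card_le`).
3. `character`, `quotCharacter` — for `σ ∈ I` the character `χ_σ : x ↦ (σx/x)̄`,
   `Mˣ → κ(O_M)ˣ`, trivial on `Kˣ·O_Mˣ`, i.e. a character of `Mˣ/(Kˣ·O_Mˣ) ≅ vM/vK`, a group of
   order `e` (`ramificationIndex_eq_index`, `DefectlessComposite.lean`).
4. `algEquiv_eq_one_of_forall_valuation_div_sub_one_lt` — **the ramification group is trivial in
   residue characteristic `0`**: if `|ρx/x - 1| < 1` for all `x ≠ 0` then `ρ = 1` (with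
   `n = ord ρ`, a unit of `O_M`, and `S(x) = ∑_{i<n} ρⁱx = x·(n + 𝔪)`: `S(x) ≠ 0` for `x ≠ 0`,
   while `S(x - S(x)/n) = 0`; so `x = S(x)/n` is fixed by `ρ`). Hence `σ ↦ χ_σ` is injective on
   `I` (`quotCharacter_injective`) and `|I| ≤ #Hom(vM/vK, κ̄ˣ) = e`
   (`card_ker_residueGaloisHom_le`; the count of characters with values in the algebraic closure
   `κ̄` of `κ(O_M)`, of characteristic `0`, is Mathlib's duality
   `CommGroup.card_monoidHom_of_hasEnoughRootsOfUnity`).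
5. `finrank_eq_ramificationIndex_mul_inertiaDegree_of_isGalois` — `[M : K] = |G| ≤ e·f ≤ [M : K]`
   (fundamental inequality, `ramificationIndex_mul_inertiaDegree_le_finrank`), so `K` is
   defectless in `M` (`isDefectlessIn_of_isGalois_of_isHenselianField`); for an arbitrary finite
   `L|K` (`char K = 0`, so `L|K` is separable) one passes to the normal closure and descends with
   `IsDefectlessIn.of_tower_top` (`DefectTowers.lean`, Lemma 2.13 at finite level).

## Main results (all PROVED)

* `isDefectlessField_of_isHenselianField_of_charZero` — Ostrowski's lemma with `p = 1`: a
  henselian valued field (`IsHenselianField`) of residue characteristic `0` is a defectless field.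
* `Kuhlmann2010DefectlessOfResidueCharZero_holds : Kuhlmann2010DefectlessOfResidueCharZero` —
  **Cor. 2.12**; `isDefectlessField_of_charZero_residueField` — its typed form.

## Sources

* F.-V. Kuhlmann, *Elimination of ramification I: The generalized stability theorem*, Trans.
  Amer. Math. Soc. 362 (2010) 5697–5727 = arXiv:1003.5678: §1 (p. 3), §2.3 ((9), Cor. 2.12,
  Thm. 2.14; p. 7). [Kuhlmann2010]
* For Ostrowski's lemma the source cites [En] = O. Endler, *Valuation theory*, Springer 1972
  and [R] = P. Ribenboim, *Théorie des valuations*, Presses Univ. Montréal; the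
  inertia/ramification-group argument used here is the classical one of O. Zariski, P. Samuel,
  *Commutative Algebra* II (1960), Ch. VI §12, Thm. 24, Thm. 25 and Corollary. [folklore]

## Rendering notes

* As in `ValuationDefect.lean`: an extension of valued fields is `[Algebra K M]` plus a valuation
  ring `O_M` of `M`, the ring of `K` being `O_M.comap (algebraMap K M)`; `e = ramificationIndex`,
  `f = inertiaDegree`, "defectless in `M`" = `IsDefectlessIn`, "defectless field" =
  `IsDefectlessField`, "henselian" = `IsHenselianField` (uniqueness of extensions to algebraic
  extensions).
* The decomposition group is all of `Aut(M|K)` here (the valuation ring is unique), so the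
  inertia group is rendered directly as the kernel of `residueGaloisHom : Aut(M|K) →*
  Aut(κ(O_M)|κ(O_M ∩ K))` rather than through Mathlib's `ValuationSubring.inertiaSubgroup` (a
  subgroup of the decomposition subgroup); the ramification group is not introduced as a
  subgroup — only the statement that its elements are trivial is needed.
* The character count is isolated in `card_le_card_of_injective_monoidHom`, stated for an
  abstract finite abelian group (instantiating Mathlib's duality at the concrete quotient
  `Mˣ ⧸ unitsSup K O_M` makes the elaborator compare `Monoid` instances of the quotient group
  expensively).
-/

noncomputable section

open IsLocalRing

namespace Literature.AlgebraicGeometry.Resolution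

universe u

/-! ### Automorphisms stabilising the valuation ring preserve the valuation -/

section Stable

variable {K M : Type u} [Field K] [Field M] [Algebra K M] (OM : ValuationSubring M)

/-- If `O_M` is the ONLY valuation ring of `M` over `O_M ∩ K` (e.g. `K` henselian), then every
`K`-automorphism `σ` of `M` stabilises it: `σ x ∈ O_M ↔ x ∈ O_M` (`σ⁻¹(O_M)` lies over
`O_M ∩ K` as well). [folklore] -/
theorem algEquiv_apply_mem_iff_of_forall_comap_eq
    (huniq : ∀ O' : ValuationSubring M,
      O'.comap (algebraMap K M) = OM.comap (algebraMap K M) → O' = OM)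
    (σ : M ≃ₐ[K] M) (x : M) : σ x ∈ OM ↔ x ∈ OM := by
  have h : OM.comap (σ : M →+* M) = OM := by
    refine huniq _ ?_
    ext c
    simp only [ValuationSubring.mem_comap, RingHom.coe_coe, AlgEquiv.commutes]
  conv_rhs => rw [← h]
  rw [ValuationSubring.mem_comap]
  rfl

variable {OM}

/-- For `σ` stabilising `O_M`: `|σ a| ≤ |σ b| ↔ |a| ≤ |b|`. [folklore] -/
theorem valuation_algEquiv_le_iff (hstab : ∀ (σ : M ≃ₐ[K] M) (x : M), σ x ∈ OM ↔ x ∈ OM)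
    (σ : M ≃ₐ[K] M) (a b : M) :
    OM.valuation (σ a) ≤ OM.valuation (σ b) ↔ OM.valuation a ≤ OM.valuation b := by
  by_cases hb : b = 0
  · subst hb
    simp only [map_zero, le_zero_iff, map_eq_zero]
  · have hb' : σ b ≠ 0 := (EmbeddingLike.map_ne_zero_iff).mpr hb
    have h0 : 0 < OM.valuation b := zero_lt_iff.mpr ((Valuation.ne_zero_iff _).mpr hb)
    have h0' : 0 < OM.valuation (σ b) := zero_lt_iff.mpr ((Valuation.ne_zero_iff _).mpr hb')
    rw [← div_le_one₀ h0, ← div_le_one₀ h0', ← map_div₀, ← map_div₀, ← map_div₀,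
      OM.valuation_le_one_iff, OM.valuation_le_one_iff, hstab]

/-- For `σ` stabilising `O_M`: `|σ a| < |σ b| ↔ |a| < |b|`, also for the powers of `σ`.
[folklore] -/
theorem valuation_pow_algEquiv_lt_iff (hstab : ∀ (σ : M ≃ₐ[K] M) (x : M), σ x ∈ OM ↔ x ∈ OM)
    (σ : M ≃ₐ[K] M) (k : ℕ) (a b : M) :
    OM.valuation ((σ ^ k) a) < OM.valuation ((σ ^ k) b) ↔ OM.valuation a < OM.valuation b := by
  induction k generalizing a b with
  | zero => simp only [pow_zero, AlgEquiv.one_apply]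
  | succ k ih =>
    rw [pow_succ, AlgEquiv.mul_apply, AlgEquiv.mul_apply, ih, ← not_le, ← not_le,
      valuation_algEquiv_le_iff hstab]

/-- **`v ∘ σ = v`**: a `K`-automorphism of finite order stabilising `O_M` preserves the valuation
(if `|x| < |σ x|` then `|x| < |σ x| < |σ² x| < ⋯ < |σⁿ x| = |x|`). [folklore] -/
theorem valuation_algEquiv_apply [Finite (M ≃ₐ[K] M)]
    (hstab : ∀ (σ : M ≃ₐ[K] M) (x : M), σ x ∈ OM ↔ x ∈ OM) (σ : M ≃ₐ[K] M) (x : M) :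
    OM.valuation (σ x) = OM.valuation x := by
  -- no `σ` increases a value
  have key : ∀ (σ : M ≃ₐ[K] M) (x : M), ¬ OM.valuation x < OM.valuation (σ x) := by
    intro σ x hx
    obtain ⟨n, hn, hσn⟩ := (isOfFinOrder_of_finite σ).exists_pow_eq_one
    have hchain : ∀ k : ℕ, OM.valuation x < OM.valuation ((σ ^ (k + 1)) x) := by
      intro k
      induction k with
      | zero => simpa only [zero_add, pow_one] using hx
      | succ k ih =>
        have h2 : OM.valuation ((σ ^ (k + 1)) x) < OM.valuation ((σ ^ (k + 1)) (σ x)) :=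
          (valuation_pow_algEquiv_lt_iff hstab σ (k + 1) x (σ x)).mpr hx
        rw [← AlgEquiv.mul_apply, ← pow_succ] at h2
        exact ih.trans h2
    have h := hchain (n - 1)
    rw [Nat.sub_add_cancel hn, hσn, AlgEquiv.one_apply] at h
    exact lt_irrefl _ h
  rcases lt_trichotomy (OM.valuation (σ x)) (OM.valuation x) with h | h | h
  · refine absurd ?_ (key σ.symm (σ x))
    rwa [AlgEquiv.symm_apply_apply]
  · exact h
  · exact absurd h (key σ x)

/-- `σ x / x` is a unit of the valuation ring for `σ` preserving the valuation. [folklore] -/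
theorem valuation_algEquiv_apply_div [Finite (M ≃ₐ[K] M)]
    (hstab : ∀ (σ : M ≃ₐ[K] M) (x : M), σ x ∈ OM ↔ x ∈ OM) (σ : M ≃ₐ[K] M) {x : M} (hx : x ≠ 0) :
    OM.valuation (σ x / x) = 1 := by
  rw [map_div₀, valuation_algEquiv_apply hstab, div_self ((Valuation.ne_zero_iff _).mpr hx)]

end Stable

/-! ### The ramification group is trivial in residue characteristic `0` -/

section Ramification

variable {K M : Type u} [Field K] [Field M] [Algebra K M] {OM : ValuationSubring M}

/-- A product of two principal units is a principal unit. [folklore] -/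
theorem valuation_mul_sub_one_lt_one {a b : M} (ha : OM.valuation (a - 1) < 1)
    (hb : OM.valuation (b - 1) < 1) : OM.valuation (a * b - 1) < 1 := by
  have ha1 : OM.valuation a ≤ 1 := by
    have : a = (a - 1) + 1 := by ring
    rw [this]
    refine (OM.valuation.map_add _ _).trans ?_
    rw [Valuation.map_one]
    exact max_le ha.le le_rfl
  have h : a * b - 1 = a * (b - 1) + (a - 1) := by ring
  rw [h]
  refine Valuation.map_add_lt _ ?_ ha
  rw [Valuation.map_mul]
  calc OM.valuation a * OM.valuation (b - 1) ≤ 1 * OM.valuation (b - 1) :=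
        mul_le_mul_left ha1 _
    _ < 1 := by rwa [one_mul]

/-- In residue characteristic `0`, a positive natural number is a unit of the valuation ring.
[folklore] -/
theorem valuation_natCast_eq_one [CharZero (ResidueField OM)] {n : ℕ} (hn : 0 < n) :
    OM.valuation (n : M) = 1 := by
  have hmem : ((n : M)) ∈ OM := natCast_mem OM n
  have hunit : IsUnit (⟨(n : M), hmem⟩ : OM) := by
    by_contra hnu
    have h0 : residue OM ⟨(n : M), hmem⟩ = 0 :=
      (residue_eq_zero_iff _).mpr ((IsLocalRing.mem_maximalIdeal _).mpr hnu)
    have hcast : (⟨(n : M), hmem⟩ : OM) = (n : OM) := Subtype.ext (by simp)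
    rw [hcast, map_natCast, Nat.cast_eq_zero] at h0
    exact hn.ne' h0
  exact (OM.valuation_eq_one_iff _).mp hunit

/-- **The ramification group is trivial in residue characteristic `0`.** Let `ρ` be a
`K`-automorphism of `M` of finite order with `|ρ x / x - 1| < 1` for all `x ≠ 0` (an element of
the ramification group of `O_M`). If `char κ(O_M) = 0`, then `ρ = 1`: with `n` the order of `ρ`
and `S(x) = ∑_{i<n} ρⁱ(x)`, one has `S(x) = x·u` with `u ≡ n ≢ 0` modulo the maximal ideal, so
`S(x) ≠ 0` for `x ≠ 0`; but `x' = x - S(x)/n` has `S(x') = 0`, whence `x = S(x)/n` is fixed by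
`ρ`. (Classically: the large ramification group is a `π`-group, `π` the residue characteristic,
and trivial in residue characteristic zero — Zariski–Samuel II, Ch. VI §12, Thm. 24.) [folklore] -/
theorem algEquiv_eq_one_of_forall_valuation_div_sub_one_lt [Finite (M ≃ₐ[K] M)]
    [CharZero (ResidueField OM)] (ρ : M ≃ₐ[K] M)
    (hρ : ∀ x : M, x ≠ 0 → OM.valuation (ρ x / x - 1) < 1) : ρ = 1 := by
  classical
  set n := orderOf ρ with hn_def
  have hnpos : 0 < n := orderOf_pos ρ
  have hnv : OM.valuation (n : M) = 1 := valuation_natCast_eq_one hnpos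
  have hnM : (n : M) ≠ 0 := fun h => by
    rw [h, Valuation.map_zero] at hnv
    exact zero_ne_one hnv
  -- the averaging operator `S`
  let S : M → M := fun x => ∑ i ∈ Finset.range n, (ρ ^ i) x
  have hS_fix : ∀ x, ρ (S x) = S x := by
    intro x
    simp only [S, map_sum]
    have h1 : ∀ i, ρ ((ρ ^ i) x) = (ρ ^ (i + 1)) x := fun i => by
      rw [pow_succ', AlgEquiv.mul_apply]
    simp_rw [h1]
    have hρn : ρ ^ n = 1 := by
      rw [hn_def]
      exact pow_orderOf_eq_one ρ
    have h2 := Finset.sum_range_succ' (fun i => (ρ ^ i) x) n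
    have h3 := Finset.sum_range_succ (fun i => (ρ ^ i) x) n
    rw [h3, hρn, pow_zero] at h2
    exact (add_right_cancel h2).symm
  have hS_sub : ∀ x y, S (x - y) = S x - S y := fun x y => by
    simp only [S, map_sub, Finset.sum_sub_distrib]
  have hpow : ∀ (i : ℕ) (x : M), x ≠ 0 → OM.valuation ((ρ ^ i) x / x - 1) < 1 := by
    intro i
    induction i with
    | zero =>
      intro x hx
      simp only [pow_zero, AlgEquiv.one_apply, div_self hx, sub_self, Valuation.map_zero,
        zero_lt_one]
    | succ i ih =>
      intro x hx
      have hy : (ρ ^ i) x ≠ 0 := (EmbeddingLike.map_ne_zero_iff).mpr hx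
      have h : (ρ ^ (i + 1)) x / x = (ρ ((ρ ^ i) x) / (ρ ^ i) x) * ((ρ ^ i) x / x) := by
        rw [pow_succ', AlgEquiv.mul_apply, div_mul_div_cancel₀ hy]
      rw [h]
      exact valuation_mul_sub_one_lt_one (hρ _ hy) (ih x hx)
  have hS_ne : ∀ x, x ≠ 0 → S x ≠ 0 := by
    intro x hx
    set u : M := ∑ i ∈ Finset.range n, (ρ ^ i) x / x with hu_def
    have hSx : S x = x * u := by
      simp only [S, hu_def, Finset.mul_sum]
      exact Finset.sum_congr rfl fun i _ => (mul_div_cancel₀ _ hx).symm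
    have hun : OM.valuation (u - n) < 1 := by
      have h : u - n = ∑ i ∈ Finset.range n, ((ρ ^ i) x / x - 1) := by
        simp only [hu_def, Finset.sum_sub_distrib, Finset.sum_const, Finset.card_range,
          nsmul_eq_mul, mul_one]
      rw [h]
      exact Valuation.map_sum_lt _ one_ne_zero fun i _ => hpow i x hx
    have hu : OM.valuation u = 1 := by
      have h : u = (n : M) + (u - n) := by ring
      rw [h, Valuation.map_add_eq_of_lt_left _ (by rwa [hnv]), hnv]
    have hu0 : u ≠ 0 := fun h => by
      rw [h, Valuation.map_zero] at hu
      exact zero_ne_one hu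
    rw [hSx]
    exact mul_ne_zero hx hu0
  -- every `x` is fixed
  refine AlgEquiv.ext fun x => ?_
  set y : M := S x / n with hy_def
  have hy : ρ y = y := by
    rw [hy_def, map_div₀, hS_fix, map_natCast]
  have hpow_y : ∀ i : ℕ, (ρ ^ i) y = y := by
    intro i
    induction i with
    | zero => rw [pow_zero, AlgEquiv.one_apply]
    | succ i ih => rw [pow_succ, AlgEquiv.mul_apply, hy, ih]
  have hSy : S y = S x := by
    have h : S y = ∑ i ∈ Finset.range n, y := Finset.sum_congr rfl fun i _ => hpow_y i
    rw [h, Finset.sum_const, Finset.card_range, nsmul_eq_mul, hy_def, mul_div_cancel₀ _ hnM]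
  have h0 : S (x - y) = 0 := by rw [hS_sub, hSy, sub_self]
  have hxy : x = y := by
    by_contra hne
    exact hS_ne _ (sub_ne_zero.mpr hne) h0
  rw [AlgEquiv.one_apply, hxy, hy]

end Ramification

/-! ### The inertia group: the action on the residue field -/

section Inertia

variable {K M : Type u} [Field K] [Field M] [Algebra K M] (OM : ValuationSubring M)
  (hstab : ∀ (σ : M ≃ₐ[K] M) (x : M), σ x ∈ OM ↔ x ∈ OM)

/-- The restriction of a `K`-automorphism stabilising `O_M` to a ring automorphism of `O_M`.
[folklore] -/
def restrictValuationSubring (σ : M ≃ₐ[K] M) : OM ≃+* OM where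
  toFun x := ⟨σ x, (hstab σ x).mpr x.2⟩
  invFun x := ⟨σ.symm x, (hstab σ.symm x).mpr x.2⟩
  left_inv x := Subtype.ext (σ.symm_apply_apply x)
  right_inv x := Subtype.ext (σ.apply_symm_apply x)
  map_mul' _ _ := Subtype.ext (map_mul σ _ _)
  map_add' _ _ := Subtype.ext (map_add σ _ _)

/-- The automorphism of the residue field `κ(O_M)` over `κ(O_M ∩ K) = residueSubfield K O_M`
induced by a `K`-automorphism stabilising `O_M` (`σ̄(x̄) = σ(x)̄`; it fixes the residues of the
elements of `K`). [folklore] -/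
def residueAlgEquiv (σ : M ≃ₐ[K] M) :
    ResidueField OM ≃ₐ[residueSubfield K OM] ResidueField OM :=
  AlgEquiv.ofRingEquiv (f := ResidueField.mapEquiv (restrictValuationSubring OM hstab σ)) (by
    rintro ⟨c, hc⟩
    obtain ⟨k, hk, rfl⟩ := (mem_residueSubfield_iff K OM c).mp hc
    change ResidueField.mapEquiv _ (residue OM ⟨algebraMap K M k, hk⟩) =
      residue OM ⟨algebraMap K M k, hk⟩
    rw [ResidueField.mapEquiv_apply, ResidueField.map_residue]
    congr 1
    exact Subtype.ext (σ.commutes k))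

/-- `σ̄(x̄) = σ(x)̄`. [folklore] -/
@[simp]
theorem residueAlgEquiv_residue (σ : M ≃ₐ[K] M) (x : OM) :
    residueAlgEquiv OM hstab σ (residue OM x) = residue OM ⟨σ x, (hstab σ x).mpr x.2⟩ :=
  rfl

/-- **The action of the Galois group on the residue field**: `σ ↦ σ̄`, a homomorphism
`Aut(M|K) → Aut(κ(O_M) | κ(O_M ∩ K))` (all of `Aut(M|K)` is the decomposition group here). Its
kernel is the inertia group. [folklore] -/
def residueGaloisHom :
    (M ≃ₐ[K] M) →* (ResidueField OM ≃ₐ[residueSubfield K OM] ResidueField OM) where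
  toFun := residueAlgEquiv OM hstab
  map_one' := by
    refine AlgEquiv.ext fun r => ?_
    obtain ⟨x, rfl⟩ := residue_surjective r
    rfl
  map_mul' σ τ := by
    refine AlgEquiv.ext fun r => ?_
    obtain ⟨x, rfl⟩ := residue_surjective r
    rfl

/-- Elements of the inertia group (the kernel of `σ ↦ σ̄`) move every element of `O_M` within
its residue class: `|σ x - x| < 1`. [folklore] -/
theorem valuation_sub_lt_one_of_mem_ker {σ : M ≃ₐ[K] M}
    (hσ : σ ∈ (residueGaloisHom OM hstab).ker) {x : M} (hx : x ∈ OM) :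
    OM.valuation (σ x - x) < 1 := by
  rw [MonoidHom.mem_ker] at hσ
  have h : residueAlgEquiv OM hstab σ (residue OM ⟨x, hx⟩) = residue OM ⟨x, hx⟩ := by
    change residueGaloisHom OM hstab σ (residue OM ⟨x, hx⟩) = _
    rw [hσ, AlgEquiv.one_apply]
  rw [residueAlgEquiv_residue, ← sub_eq_zero, ← map_sub, residue_eq_zero_iff,
    ValuationSubring.valuation_lt_one_iff] at h
  exact h

/-- **`[G : I] ≤ f`**: the index of the inertia group is at most the inertia degree
(`G/I` embeds into `Aut(κ(O_M) | κ(O_M ∩ K))`, which has at most `[κ(O_M) : κ(O_M ∩ K)]`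
elements by Dedekind's independence of characters). [folklore] -/
theorem card_quotient_ker_residueGaloisHom_le [FiniteDimensional K M] :
    Nat.card ((M ≃ₐ[K] M) ⧸ (residueGaloisHom OM hstab).ker) ≤ inertiaDegree K OM := by
  haveI : FiniteDimensional (residueSubfield K OM) (ResidueField OM) :=
    (ramificationIndex_mul_inertiaDegree_le_finrank K OM).2.1
  rw [Nat.card_congr (QuotientGroup.quotientKerEquivRange (residueGaloisHom OM hstab)).toEquiv]
  calc Nat.card (residueGaloisHom OM hstab).range
      ≤ Nat.card (ResidueField OM ≃ₐ[residueSubfield K OM] ResidueField OM) :=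
        Nat.card_le_card_of_injective _ Subtype.val_injective
    _ = Fintype.card (ResidueField OM ≃ₐ[residueSubfield K OM] ResidueField OM) :=
        Nat.card_eq_fintype_card
    _ ≤ Module.finrank (residueSubfield K OM) (ResidueField OM) := AlgEquiv.card_le
    _ = inertiaDegree K OM := rfl

end Inertia

/-! ### The inertia group: characters on the value group -/

section Characters

variable {K M : Type u} [Field K] [Field M] [Algebra K M] [FiniteDimensional K M]
  (OM : ValuationSubring M) (hstab : ∀ (σ : M ≃ₐ[K] M) (x : M), σ x ∈ OM ↔ x ∈ OM)

/-- `x ↦ σ x / x`, a homomorphism `Mˣ → O_Mˣ` for `σ` preserving the valuation. [folklore] -/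
def crossedHom (σ : M ≃ₐ[K] M) : Mˣ →* OM.unitGroup where
  toFun x := ⟨Units.map (σ : M →* M) x * x⁻¹, by
    rw [ValuationSubring.mem_unitGroup_iff, Units.val_mul, Units.coe_map, MonoidHom.coe_coe,
      Units.val_inv_eq_inv_val, ← div_eq_mul_inv]
    exact valuation_algEquiv_apply_div hstab σ x.ne_zero⟩
  map_one' := Subtype.ext (by simp)
  map_mul' x y := Subtype.ext (by
    simp only [map_mul, mul_inv, Subgroup.coe_mul]
    exact mul_mul_mul_comm _ _ _ _)

/-- `(σ x / x : M)`. [folklore] -/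
@[simp]
theorem coe_crossedHom_apply (σ : M ≃ₐ[K] M) (x : Mˣ) :
    (((crossedHom OM hstab σ x : OM.unitGroup) : Mˣ) : M) = σ x / x := by
  simp [crossedHom, div_eq_mul_inv]

/-- **The character of `σ`**: `x ↦ (σ x / x)̄`, `Mˣ → κ(O_M)ˣ`. [folklore] -/
def character (σ : M ≃ₐ[K] M) : Mˣ →* (ResidueField OM)ˣ :=
  OM.unitGroupToResidueFieldUnits.comp (crossedHom OM hstab σ)

/-- `χ_σ(x) = 1 ↔ |σ x / x - 1| < 1`. [folklore] -/
theorem character_apply_eq_one_iff (σ : M ≃ₐ[K] M) (x : Mˣ) :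
    character OM hstab σ x = 1 ↔ OM.valuation (σ x / x - 1) < 1 := by
  rw [character, MonoidHom.comp_apply, ← MonoidHom.mem_ker,
    ValuationSubring.ker_unitGroupToResidueFieldUnits, Subgroup.mem_comap,
    ValuationSubring.mem_principalUnitGroup_iff, Subgroup.coe_subtype, coe_crossedHom_apply]

/-- For `σ` in the inertia group, `χ_σ` is trivial on `K^× · O_M^×` (`σ` fixes `K`; a unit `u`
has `σ u ≡ u`, so `σ u / u ≡ 1`). [folklore] -/
theorem unitsSup_le_ker_character {σ : M ≃ₐ[K] M}
    (hσ : σ ∈ (residueGaloisHom OM hstab).ker) : unitsSup K OM ≤ (character OM hstab σ).ker := by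
  refine sup_le ?_ ?_
  · rintro _ ⟨c, rfl⟩
    rw [MonoidHom.mem_ker, character_apply_eq_one_iff, Units.coe_map, MonoidHom.coe_coe,
      AlgEquiv.commutes, div_self (by simp), sub_self, Valuation.map_zero]
    exact zero_lt_one
  · intro x hx
    rw [ValuationSubring.mem_unitGroup_iff] at hx
    rw [MonoidHom.mem_ker, character_apply_eq_one_iff]
    have hxO : (x : M) ∈ OM := (OM.valuation_le_one_iff _).mp hx.le
    have h : σ x / x - 1 = (σ x - x) / x := by field_simp
    rw [h, map_div₀, hx, div_one]
    exact valuation_sub_lt_one_of_mem_ker OM hstab hσ hxO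

/-- **The character of an element of the inertia group on `Mˣ/(Kˣ·O_Mˣ) ≅ vM/vK`**, with values
in the units of the algebraic closure of the residue field. [folklore] -/
def quotCharacter (σ : (residueGaloisHom OM hstab).ker) :
    Mˣ ⧸ unitsSup K OM →* (AlgebraicClosure (ResidueField OM))ˣ :=
  (Units.map (algebraMap (ResidueField OM) (AlgebraicClosure (ResidueField OM)) :
      ResidueField OM →* AlgebraicClosure (ResidueField OM))).comp
    (QuotientGroup.lift (unitsSup K OM) (character OM hstab σ)
      (unitsSup_le_ker_character OM hstab σ.2))

/-- **`I` embeds into `Hom(vM/vK, κ̄ˣ)` in residue characteristic `0`**: `σ ↦ χ_σ` is injective on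
the inertia group (if `χ_σ = χ_τ` then `ρ = τ⁻¹σ` has `|ρ x / x - 1| < 1` for all `x`, i.e. lies
in the ramification group, which is trivial). [folklore] -/
theorem quotCharacter_injective [CharZero (ResidueField OM)] :
    Function.Injective (quotCharacter OM hstab) := by
  classical
  rintro ⟨σ, hσ⟩ ⟨τ, hτ⟩ hστ
  -- `|σ x / τ x - 1| < 1` for all `x ≠ 0`
  have hkey : ∀ x : M, x ≠ 0 → OM.valuation (σ x / τ x - 1) < 1 := by
    intro x hx
    set u : Mˣ := Units.mk0 x hx with hu
    have h1 := congrArg (fun φ => φ (QuotientGroup.mk u)) hστ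
    simp only [quotCharacter, MonoidHom.comp_apply, QuotientGroup.lift_mk] at h1
    have h2 : character OM hstab σ u = character OM hstab τ u := by
      refine Units.ext
        ((algebraMap (ResidueField OM) (AlgebraicClosure (ResidueField OM))).injective ?_)
      simpa only [Units.coe_map, MonoidHom.coe_coe] using
        congrArg (fun w : (AlgebraicClosure (ResidueField OM))ˣ =>
          (w : AlgebraicClosure (ResidueField OM))) h1
    have h3 : OM.unitGroupToResidueFieldUnits
        (crossedHom OM hstab σ u * (crossedHom OM hstab τ u)⁻¹) = 1 := by
      rw [map_mul, map_inv]
      change character OM hstab σ u * (character OM hstab τ u)⁻¹ = 1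
      rw [h2, mul_inv_cancel]
    rw [← MonoidHom.mem_ker, ValuationSubring.ker_unitGroupToResidueFieldUnits, Subgroup.mem_comap,
      ValuationSubring.mem_principalUnitGroup_iff, Subgroup.coe_subtype, Subgroup.coe_mul,
      Subgroup.coe_inv, Units.val_mul, Units.val_inv_eq_inv_val, coe_crossedHom_apply,
      coe_crossedHom_apply] at h3
    have hτx : τ x ≠ 0 := (EmbeddingLike.map_ne_zero_iff).mpr hx
    have h4 : σ (u : M) / (u : M) * (τ (u : M) / (u : M))⁻¹ = σ x / τ x := by
      simp only [hu, Units.val_mk0]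
      field_simp
    rwa [h4] at h3
  -- hence `τ⁻¹ σ` lies in the ramification group, which is trivial
  have hρ : ∀ x : M, x ≠ 0 → OM.valuation ((τ⁻¹ * σ) x / x - 1) < 1 := by
    intro x hx
    have h : (τ⁻¹ * σ) x / x - 1 = τ.symm (σ x / τ x - 1) := by
      rw [AlgEquiv.mul_apply, AlgEquiv.aut_inv, map_sub, map_one, map_div₀,
        AlgEquiv.symm_apply_apply]
    rw [h, valuation_algEquiv_apply hstab]
    exact hkey x hx
  have h1 : τ⁻¹ * σ = 1 :=
    algEquiv_eq_one_of_forall_valuation_div_sub_one_lt (OM := OM) (τ⁻¹ * σ) hρ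
  rw [inv_mul_eq_one] at h1
  exact Subtype.ext h1.symm

/-- Counting through characters: an injection of `α` into `Hom(G, Fˣ)`, for a finite abelian group
`G` and an algebraically closed field `F` of characteristic `0` (which has enough roots of unity
of order the exponent of `G`, so that `#Hom(G, Fˣ) = #G`), bounds `#α` by `#G`. [folklore] -/
theorem card_le_card_of_injective_monoidHom {α G F : Type*} [CommGroup G] [Finite G] [Field F]
    [IsAlgClosed F] [CharZero F] (f : α → (G →* Fˣ)) (hf : Function.Injective f) :
    Nat.card α ≤ Nat.card G := by
  haveI : NeZero ((Monoid.exponent G : ℕ) : F) :=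
    ⟨Nat.cast_ne_zero.mpr Monoid.exponent_ne_zero_of_finite⟩
  have hcard : Nat.card (G →* Fˣ) = Nat.card G :=
    CommGroup.card_monoidHom_of_hasEnoughRootsOfUnity G F
  haveI : Finite (G →* Fˣ) := Nat.finite_of_card_ne_zero (by rw [hcard]; exact Nat.card_pos.ne')
  exact hcard ▸ Nat.card_le_card_of_injective f hf

/-- **`|I| ≤ e`**: in residue characteristic `0` the inertia group embeds into
`Hom(Mˣ/(Kˣ·O_Mˣ), κ̄ˣ)`, a group of order `[Mˣ : Kˣ·O_Mˣ] = e` (duality for finite abelian groups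
with enough roots of unity in the algebraic closure `κ̄` of the residue field, of characteristic
`0`). [folklore] -/
theorem card_ker_residueGaloisHom_le [CharZero (ResidueField OM)] :
    Nat.card (residueGaloisHom OM hstab).ker ≤ ramificationIndex K OM := by
  have hidx : (unitsSup K OM).index = ramificationIndex K OM :=
    (ramificationIndex_eq_index K OM).symm
  have he : 1 ≤ ramificationIndex K OM := (one_le_ramificationIndex_and_inertiaDegree K OM).1
  haveI : (unitsSup K OM).FiniteIndex := ⟨by rw [hidx]; exact Nat.one_le_iff_ne_zero.mp he⟩
  haveI : Finite (Mˣ ⧸ unitsSup K OM) := Subgroup.finite_quotient_of_finiteIndex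
  calc Nat.card (residueGaloisHom OM hstab).ker
      ≤ Nat.card (Mˣ ⧸ unitsSup K OM) :=
        card_le_card_of_injective_monoidHom _ (quotCharacter_injective OM hstab)
    _ = (unitsSup K OM).index := rfl
    _ = ramificationIndex K OM := hidx

end Characters

/-! ### Ostrowski's lemma with `p = 1`: henselian fields of residue characteristic `0` -/

section Galois

variable {K M : Type u} [Field K] [Field M] [Algebra K M] [FiniteDimensional K M]

/-- **`[M : K] = e·f` for a finite Galois extension with a stable valuation ring, in residue
characteristic `0`**: `[M : K] = |G| = [G : I]·|I| ≤ f·e ≤ [M : K]` (fundamental inequality).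
[folklore] -/
theorem finrank_eq_ramificationIndex_mul_inertiaDegree_of_isGalois [IsGalois K M]
    (OM : ValuationSubring M) [CharZero (ResidueField OM)]
    (hstab : ∀ (σ : M ≃ₐ[K] M) (x : M), σ x ∈ OM ↔ x ∈ OM) :
    Module.finrank K M = ramificationIndex K OM * inertiaDegree K OM := by
  refine le_antisymm ?_ (ramificationIndex_mul_inertiaDegree_le_finrank K OM).2.2
  rw [← IsGalois.card_aut_eq_finrank,
    Subgroup.card_eq_card_quotient_mul_card_subgroup (residueGaloisHom OM hstab).ker, mul_comm]
  exact Nat.mul_le_mul (card_ker_residueGaloisHom_le OM hstab)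
    (card_quotient_ker_residueGaloisHom_le OM hstab)

/-- **A henselian field of residue characteristic `0` is defectless in every finite Galois
extension**: the extension `O_M` of `O` to `M` exists (Chevalley) and is unique (henselian), hence
stable under `Gal(M|K)`, its residue field has characteristic `0` with `κ(O)`, and
`[M : K] = e·f`. [folklore] -/
theorem isDefectlessIn_of_isGalois_of_isHenselianField [IsGalois K M] (O : ValuationSubring K)
    (hK : IsHenselianField K O) [CharZero (ResidueField O)] : IsDefectlessIn K O M := by
  classical
  haveI : Algebra.IsAlgebraic K M := Algebra.IsAlgebraic.of_finite K M
  obtain ⟨OM, hOM⟩ := exists_valuationSubring_comap_eq (Ω := M) O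
  have huniq : ∀ O' : ValuationSubring M,
      O'.comap (algebraMap K M) = OM.comap (algebraMap K M) → O' = OM :=
    fun O' h => hK.eq_of_comap_eq (h.trans hOM) hOM
  have hstab := algEquiv_apply_mem_iff_of_forall_comap_eq OM huniq
  haveI : CharZero (ResidueField OM) := by
    haveI : CharZero (ResidueField (OM.comap (algebraMap K M))) := by
      rw [hOM]
      infer_instance
    exact (RingHom.charZero_iff (residueFieldHom K OM).injective).mp inferInstance
  have hn := finrank_eq_ramificationIndex_mul_inertiaDegree_of_isGalois OM hstab
  refine ⟨{OM}, fun O'' => ?_, by rw [Finset.sum_singleton, ← hn]⟩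
  rw [Finset.mem_singleton]
  constructor
  · rintro rfl
    exact hOM
  · intro h
    exact huniq O'' (h.trans hOM.symm)

end Galois

/-- **Ostrowski's lemma with `p = 1`: a henselian valued field of residue characteristic `0` is a
defectless field** (Kuhlmann 2010, §2.3: "Assume that `(L|K,v)` is a finite extension and the
extension of `v` from `K` to `L` is unique. Then the Lemma of Ostrowski says that
`[L:K] = (vL:vK)·[Lv:Kv]·p^ν` with `ν ≥ 0` where `p` is the characteristic exponent of `Kv` …
Note that `(L|K,v)` is always defectless if `char Kv = 0`"). PROVED: `char K = 0`, so a finite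
`L|K` is separable and sits in a finite Galois extension `N|K` (the normal closure), in which `K`
is defectless (`isDefectlessIn_of_isGalois_of_isHenselianField`); defectlessness descends to the
intermediate field `L` (`IsDefectlessIn.of_tower_top`, from the fundamental inequality and the
multiplicativity of `e`, `f`). [cite: Kuhlmann2010, Section 2.3, (9)] -/
theorem isDefectlessField_of_isHenselianField_of_charZero (K : Type u) [Field K]
    (O : ValuationSubring K) (hK : IsHenselianField K O) [CharZero (ResidueField O)] :
    IsDefectlessField K O := by
  intro L _ _ hfin
  haveI := hfin
  haveI : CharZero O := RingHom.charZero (residue O)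
  haveI : CharZero K :=
    (RingHom.charZero_iff (ϕ := O.subtype) Subtype.val_injective).mp inferInstance
  haveI : IsGalois K (IntermediateField.normalClosure K L (AlgebraicClosure L)) := inferInstance
  haveI : FiniteDimensional L (IntermediateField.normalClosure K L (AlgebraicClosure L)) :=
    Module.Finite.of_restrictScalars_finite K L _
  exact IsDefectlessIn.of_tower_top (L := L)
    (M := IntermediateField.normalClosure K L (AlgebraicClosure L)) O
    (isDefectlessIn_of_isGalois_of_isHenselianField O hK)

/-! ### Kuhlmann 2010, Cor. 2.12 -/

/-- **Kuhlmann 2010, Cor. 2.12: every valued field `(K,v)` with `char Kv = 0` is a defectless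
field** — discharge of the named fact `Kuhlmann2010DefectlessOfResidueCharZero`
(`HenselizedFunctionFields.lean`). PROVED along the printed route ("a consequence of the Lemma of
Ostrowski", §1; "Therefore, Corollary 2.12", §2.3): extend `v` to `Ω = K̃` (Chevalley), identify
`K` with its image `E ⊆ Ω` (`IsDefectlessField.congr`); the henselization `E^h` is henselian
(`Kuhlmann2010HenselizationIsHenselian_holds`) of residue characteristic `0`, hence defectless by
Ostrowski's lemma with `p = 1` (`isDefectlessField_of_isHenselianField_of_charZero`), and `E` is
defectless iff `E^h` is (Thm. 2.14, `Kuhlmann2010DefectlessIffHenselization_holds`).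
[cite: Kuhlmann2010, Cor. 2.12] -/
theorem Kuhlmann2010DefectlessOfResidueCharZero_holds :
    Kuhlmann2010DefectlessOfResidueCharZero.{u} := by
  intro K _ O hchar
  haveI := hchar
  -- fix an extension `V` of `v` to the algebraic closure `Ω = K̃`
  obtain ⟨V, hV⟩ := exists_valuationSubring_comap_eq (Ω := AlgebraicClosure K) O
  subst hV
  haveI : CharZero (ResidueField V) :=
    (RingHom.charZero_iff (residueFieldHom K V).injective).mp hchar
  -- the image `E ⊆ Ω` of `K` and `ψ : K ≃ E`
  let ψ : K ≃+* (algebraMap K (AlgebraicClosure K)).fieldRange :=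
    RingEquiv.ofBijective (algebraMap K (AlgebraicClosure K)).rangeRestrictField
      (algebraMap K (AlgebraicClosure K)).rangeRestrictField_bijective
  have hOψ : V.comap (algebraMap K (AlgebraicClosure K)) =
      (V.comap (algebraMap (algebraMap K (AlgebraicClosure K)).fieldRange
        (AlgebraicClosure K))).comap ψ.toRingHom := by
    ext y
    simp only [ValuationSubring.mem_comap]
    exact Iff.rfl
  -- `E^h` is henselian of residue characteristic `0`, hence defectless (Ostrowski, `p = 1`)
  have hEh : IsDefectlessField
      (henselization V (algebraMap K (AlgebraicClosure K)).fieldRange)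
      (V.comap (algebraMap (henselization V (algebraMap K (AlgebraicClosure K)).fieldRange)
        (AlgebraicClosure K))) := by
    haveI : CharZero (ResidueField (V.comap (algebraMap
        (henselization V (algebraMap K (AlgebraicClosure K)).fieldRange) (AlgebraicClosure K)))) :=
      (residueFieldHom _ V).charZero
    exact isDefectlessField_of_isHenselianField_of_charZero _ _
      (Kuhlmann2010HenselizationIsHenselian_holds _ V _)
  -- Thm. 2.14, and back to `K` along `ψ`
  have hE := (Kuhlmann2010DefectlessIffHenselization_holds (AlgebraicClosure K) V _).mpr hEh
  refine IsDefectlessField.congr ψ.symm ?_ hE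
  rw [hOψ]
  exact (comap_comap_ringEquiv_symm ψ _).symm

/-- Cor. 2.12 makes the conditional reduction `Kuhlmann2010DefectlessOfResidueCharZero.of_ostrowski`
unconditional in residue characteristic `0`; in particular the typed statement used by the
dependents: a valued field with residue field of characteristic `0` is a defectless field.
[cite: Kuhlmann2010, Cor. 2.12] -/
theorem isDefectlessField_of_charZero_residueField (K : Type u) [Field K] (O : ValuationSubring K)
    [CharZero (ResidueField O)] : IsDefectlessField K O :=
  Kuhlmann2010DefectlessOfResidueCharZero_holds K O inferInstance

end Literature.AlgebraicGeometry.Resolution
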